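import Literature.MathematicalPhysics.QuantumFieldTheory.Balaban1983to89.T4SiblingInsertion
/-!
# `Balaban1983to89.T4SmallFieldFloorCount` — the ONE residual estimate of the (η) member after (B′), the one-cube
small-field floor (Y) `T4SiblingInsertion.SmallFieldFloor` / `UniformSmallFieldFloor`, REDUCED to COUNT × SUPPRESSION:
a finite plaquette count per cube, the elementary Chernoff factor at the LOWERED threshold of design (η), and a
threshold-free exponential-moment residual (Y′) of printed TYPE — with the floor constant explicit

HONEST FRAMING (cell `pub-balaban/t4`, node U5b / estimate NE7c, lineage `t4-ne7c-p2` = the COUNT × SUPPRESSION member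
of the NE7c fan-out, generation 7).  Rung (B)+1 of a FINITE four-torus `T⁴`: the object downstream is the `K`-uniform
Cauchy property of the cutoff generating functions on a FIXED finite torus (`T4IndicatorShell.ShellWeightBound` →
`T4LipschitzLedgerSocket.hybridNE7_tail_of_towers_add_levels`), NOT infinite volume, NOT a mass gap, NOT the Clay
problem, and NOT a proof of the new estimate NE7c.  Everything below is [folklore]: four Bochner-integral inequalities,
a finite union bound, the pointwise Chernoff inequality `𝟙{a ≤ |x|} ≤ e^{-γa²/2}·e^{γx²/2}` and two lemmas of real
analysis.  NO statement of Bałaban's papers is asserted and NO Literature fact is introduced: the analytic input is the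
typed HYPOTHESIS SHAPE (Y′) `ExpMomentRatio` (NOT PRINTED), the count `|P(σ)| ≤ P₀` and the smallness
`P₀·M·e^{-β} < 1` are BINDERS, and every conditional of the cell (BetaPertH, (B), (B^μ), reading U5a) stays upstream,
untouched.  The manuscripts under audit are quoted below for the MECHANISM and the LOCI of the printed large-field
factors only (page + render id, read as images), never for a disputed step.

WHERE THIS SITS.  After `T4SiblingInsertion` v1.2 §0 (B′) / §6 the design-(η) member of NE7c carries exactly ONE
unprinted estimate in its sibling binder: the floor (Y) `UniformSmallFieldFloor ν p g c` — on every fibre (the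
`Z′`-variables of an `ℝ`-event of the live window with the exterior configuration pinned; measure `ν j`), with
`g = rest″ ≥ 0` the substituted density stripped of the slot's profile factor and `p = p_σ ∈ [0, 1]` that factor,
`c · ∫ g ≤ ∫ p · g` with ONE `c > 0`; the node owner's socket consumes it as the kernel-ratio constant `rσ = c⁻¹`
(`T4LipschitzLedgerSocket` v1.1 §4′, binders `hlA`/`hlB`, via `T4SiblingInsertion.UniformSmallFieldFloor.integral_mul_le`;
cell GAPS G-ne7cp2-8).  (Y) is an anti-concentration statement AT A SPECIFIC THRESHOLD — the LOWERED threshold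
`a = (1 - ρ₀)·θ` of the Lipschitz profile of design (η) (`T4LipschitzCutoff`), below print's `θ`.  This leaf shows, in
the kernel, that (Y) is COUNT × SUPPRESSION over a THRESHOLD-FREE residual:

* COUNT (§2, structural).  The cube's profile is `1` whenever EVERY plaquette variable of the (enlarged) cube is below
  the lowered threshold — the plateau of the (η) profile; this is the shape of the printed cube function B15 p. 178
  (1.3) «χ({sup_{p⊂□~}|U_{j,□}(V_j,∂p) − 1| < ε_j(L^{k−j}η)²}) for □ ⊂ (Ω_j~⁴∖Ω~_{j+1}) ∩ Z» [render
  `1989-cmp122-large-field-I-p004`], «The cubes □ in (1.3) are the LM₂R_j-cubes of the partition of the lattice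
  T_{L^{−j}}, or the L^{−(k−j)}LM₂R_j-cubes of the lattice T_η» [ibid.].  Hence the defect `1 - p_σ` is dominated
  by the SUM over the cube's finite plaquette set `P(σ)` of the one-plaquette large-field indicators `𝟙{a ≤ |X_p|}`
  (`defect_le_count`), `|P(σ)| ≤ P₀` (a binder: the plaquette count of one enlarged `LM₂R_j`-cube; `K`-uniform under
  reading U5a because the window's ages are finitely many — NOT asserted here).
* SUPPRESSION (§3, elementary).  `𝟙{a ≤ |x|} ≤ e^{-γa²/2} · e^{γx²/2}` for `γ, a ≥ 0` (`indicator_le_exp_mul_exp`):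
  the threshold enters ONLY through the factor `e^{-γa²/2}`.
* THE RESIDUAL (Y′) (§3, hypothesis shape, NOT PRINTED).  `ExpMomentRatio ν X g γ M`: integrability and
  `∫ e^{γX²/2} · g ≤ M · ∫ g` — ONE plaquette variable's exponential (sub-Gaussian at scale `g_j`, `γ = γ₀ g_j⁻²`)
  moment under the exterior-pinned substituted density.  SPECIES: the cell's E2REL-b / NE7b-at-lowered-threshold
  family, here in its PRIMITIVE, threshold-free one-plaquette form (a one-run Gaussian-domination statement); printed
  MECHANISM: B16 p. 380 «There is the function χ^c_j(P_j), which yields the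
  factor exp(−γ₀(1/2g_j²)(B₃⁻¹ε_j)²(LM₂R_j)^{−d}|P_j|) in the usual way, using Theorem 1 [15] and (71) [16]. Here the
  volume is for the L^{−j}-scale, and γ₀ is an absolute positive constant (in this factor we may take γ₀ = 1/2). The
  function χ′^c_j(Q_j) yields the factor exp(−½γ₀(1/g_j²)(2δ_j)²(LM₂R_j)^{−2}|Q_j|), by expanding the Wilson action
  locally in the approximate fluctuation field, and using the positivity bound for the resulting quadratic form.»
  [render `1989-cmp122-large-field-II-p026`; cell `t4/CITED-FACTS-T4.md` F-T4-46, which identifies «[15]» = B11 and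
  «[16]» = B10 via [I]'s reference list], and B16 p. 381 «These are the fundamental large field factors, which control
  convergence of the expansion of the effective densities.» [render `1989-cmp122-large-field-II-p027`].  Print proves
  such factors for ITS (one-run, un-pinned) densities; the conditional, exterior-pinned form on `ℝ`'s substituted
  density `rest″` is NOT PRINTED and is NOT asserted — it is the binder `hE` below, owed by the seat instantiating
  `T4LipschitzLedger.TermRepr` (cell GAPS, successor of G-ne7cp2-8).  Whether enough of the cube's Wilson factors
  SURVIVES in `rest″` after `ℝ`'s quotients — B15 p. 176 «The quotients are still small, because some small factors in
  the regions Z′ are left for the densities in the numerator.» [render `1989-cmp122-large-field-I-p002`] — is exactly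
  the content of (Y′).  The crude alternative (drop the plaquette's Wilson factor) gives `M = e^{O(g_j⁻²)}` and is
  useless; by §5 a moment constant POLYNOMIAL in `g_j⁻¹` already suffices, `M = O(1)` is not needed — but some
  Gaussian domination at scale `g_j` IS, and that is an estimate.
* ASSEMBLY (§4).  `smallFieldFloor_of_count_suppression`: (Y) on one fibre with the EXPLICIT constant
  `c = 1 − P₀·M·e^{-γa²/2}`; `uniformSmallFieldFloor_of_count_suppression`: (Y) uniformly with `c = 1 − P₀·M·e^{-β}`
  from a uniform exponent floor `β ≤ γ_j a_j²/2` and the EXPLICIT smallness binder `P₀·M·e^{-β} < 1` (typed, never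
  asserted); `uniformSmallFieldFloor_of_budget`: fibre-DEPENDENT counts, moments and exponents with ONE defect budget
  `|P_j|·M_j·e^{-γ_j a_j²/2} ≤ 1 − c`.  §1 also records the OTHER supplier of (Y): a fibrewise «shell ≤ κ·core» inequality
  `∫ (1 - p)·g ≤ κ · ∫ p·g` gives `c = (1+κ)⁻¹` (`smallFieldFloor_of_defect_le_core`) — the shape in which the
  shell-measure member t4-ne7c-p1 states its fibre bounds (`T4ShellMeasureFibre.lintegral_shell_le_core`, by name; not
  imported, not instantiated here).
* DICTIONARY AND POWER COUNTING (§5, real analysis).  With the lowered threshold `a = (1 − ρ₀)·(g·P)` and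
  `γ = γ₀·g⁻²` the exponent `γa²/2 = ½γ₀(1−ρ₀)²P²` is `g`-FREE (`suppressionExponent_eq`) — the printed TYPE of the
  fundamental factors, thresholds being `g·p₀(g)·(…)`: B15 p. 175 «so we have |U(∂p) − 1| ≧ g₀p₀(g₀) for a
  plaquette p∈T₁, where p₀(g₀) = A₀(log g₀^{−2})^{p₀} with a positive integer p₀» [render
  `1989-cmp122-large-field-I-p001`; F-T4-36]; so design (η)'s lowering costs exactly the factor `(1−ρ₀)²` in a
  `g`-free exponent.  And if the count × moment constant
  grows at most like `B·e^{C·x^s}` while the exponent is at least `A·x^q` with `s < q` (`x = log g⁻²`; WHICH printed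
  parameter window yields `s < q` is NOT asserted — a hypothesis; note only that `p₀(g) = A₀x^{p₀}` with `p₀` a
  positive INTEGER makes the printed-type exponent `∝ x^{2p₀}`, `2p₀ ≥ 2`, so a count × moment constant POLYNOMIAL in
  `g⁻¹`, `≤ B·e^{C·x}` (`s = 1`), would be inside the hypothesis), then `c ≥ 1/2` for `x ≥ x₀` with `x₀` explicit
  (`eventually_count_mul_suppression_le_half`, `floor_ge_half_of_powerCounting`), assembled END TO END as
  `uniformSmallFieldFloor_half_of_powerCounting`: (Y) with `c = 1/2` on every fibre whose coupling is below the
  explicit threshold (`x_j ≥ x₀`).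
* SANITY (§6).  A two-point toy fibre on which every binder of §4 is inhabited NON-degenerately (event of positive
  mass, `M > 1`, `0 < c < 1/2`) and the theorem FIRES; and a kernel-checked NEGATIVE CONTROL: the sign hypothesis
  `0 ≤ a` of the Chernoff step cannot be dropped.

WHAT THIS BUYS, EXACTLY (no more).  The residual of the (η) member moves from (Y) «conditional small-field probability
of ONE cube at the LOWERED threshold ≥ c» to (Y′) «exponential moment of ONE plaquette variable at scale g_j ≤ M»,
which is threshold-free and of the printed type; the count is the structural plaquette count of one cube and the
threshold dependence is the explicit elementary factor.  (Y′), the `K`-uniformity of `M` and `P₀`, and the smallness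
`P₀·M·e^{-β} < 1` remain BINDERS — ONE estimate is still owed, now in its primitive form.  Nothing here is infinite
volume, a mass gap, Clay, or summit progress.

ONE-WRITER / IMPORTS.  Imports `T4SiblingInsertion` (this lineage, v1.2, frozen) ONLY and uses its `SmallFieldFloor`,
`SmallFieldFloor.mono`, `UniformSmallFieldFloor` BY NAME; no file of another lineage is touched or imported
(`T4LipschitzLedgerSocket` (pv07), `T4ShellMeasureFibre` (t4-ne7c-p1), `T4AdditiveClass` (t4-ne7-p2) are named in
prose only).  Records: `t4/T4-EST-NE7c-P2.md` §12 (v1.6); journal row `T4-U5b.E2-NE7c-PROVE-P2g*`.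
-/

open MeasureTheory Finset

namespace Literature.MathematicalPhysics.QuantumFieldTheory.Balaban1983to89.T4SmallFieldFloorCount

open T4SiblingInsertion

/-! ## §1 Floors from defect bounds (one fibre)

`SmallFieldFloor ν p g c` is `c · ∫ g ≤ ∫ p·g`.  With `g` and `p·g` integrable (the instance must carry integrability —
for non-integrable data the Bochner integrals are junk `0` and the shape is vacuous; cross-read C-ref5-159) it is the
same as a bound on the DEFECT mass `∫ (1 − p)·g ≤ (1 − c) · ∫ g`.  Two suppliers: a defect bound against the total
(`c = 1 − q`), and a defect bound against the core (`c = (1 + κ)⁻¹`). [folklore] -/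

section Defect

variable {Ω₀ : Type*} [MeasurableSpace Ω₀] {ν : Measure Ω₀} {p g : Ω₀ → ℝ}

/-- The defect mass is the total minus the `p`-weighted mass (integrability of both is used). [folklore] -/
theorem integral_defect_eq (hg : Integrable g ν) (hpg : Integrable (fun ω => p ω * g ω) ν) :
    ∫ ω, (1 - p ω) * g ω ∂ν = ∫ ω, g ω ∂ν - ∫ ω, p ω * g ω ∂ν := by
  rw [← integral_sub hg hpg]
  exact integral_congr_ae (Filter.Eventually.of_forall fun ω => by ring)

/-- The defect integrand `(1 − p)·g` is integrable when `g` and `p·g` are. [folklore] -/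
theorem integrable_defect (hg : Integrable g ν) (hpg : Integrable (fun ω => p ω * g ω) ν) :
    Integrable (fun ω => (1 - p ω) * g ω) ν :=
  (hg.sub hpg).congr (Filter.Eventually.of_forall fun ω => by simp only [Pi.sub_apply]; ring)

/-- **FLOOR ⇔ DEFECT BOUND.**  `c · ∫ g ≤ ∫ p·g` iff `∫ (1 − p)·g ≤ (1 − c) · ∫ g`. [folklore] -/
theorem smallFieldFloor_iff_defect_le {c : ℝ} (hg : Integrable g ν) (hpg : Integrable (fun ω => p ω * g ω) ν) :
    SmallFieldFloor ν p g c ↔ ∫ ω, (1 - p ω) * g ω ∂ν ≤ (1 - c) * ∫ ω, g ω ∂ν := by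
  rw [SmallFieldFloor, integral_defect_eq hg hpg]
  constructor <;> intro h <;> linarith

/-- **SUPPLIER 1: a defect bound against the total mass**, `∫ (1 − p)·g ≤ q · ∫ g` ⇒ the floor with `c = 1 − q`.
(The form the count × suppression route delivers, §4.) [folklore] -/
theorem smallFieldFloor_of_defect_le {q : ℝ} (hg : Integrable g ν) (hpg : Integrable (fun ω => p ω * g ω) ν)
    (h : ∫ ω, (1 - p ω) * g ω ∂ν ≤ q * ∫ ω, g ω ∂ν) : SmallFieldFloor ν p g (1 - q) := by
  rw [smallFieldFloor_iff_defect_le hg hpg, sub_sub_cancel]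
  exact h

/-- **SUPPLIER 2: a defect bound against the core**, `∫ (1 − p)·g ≤ κ · ∫ p·g` with `κ ≥ 0` ⇒ the floor with
`c = (1 + κ)⁻¹`.  This is the shape «shell ≤ κ · core, fibre by fibre» in which the shell-measure member of the NE7c
fan-out states its bounds (`T4ShellMeasureFibre.lintegral_shell_le_core`, t4-ne7c-p1 — named, not imported); such a
bound therefore also supplies (Y).  Bookkeeping only. [folklore] -/
theorem smallFieldFloor_of_defect_le_core {κ : ℝ} (hκ : 0 ≤ κ) (hg : Integrable g ν)
    (hpg : Integrable (fun ω => p ω * g ω) ν)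
    (h : ∫ ω, (1 - p ω) * g ω ∂ν ≤ κ * ∫ ω, p ω * g ω ∂ν) : SmallFieldFloor ν p g (1 + κ)⁻¹ := by
  unfold SmallFieldFloor
  have hsum : ∫ ω, g ω ∂ν = ∫ ω, p ω * g ω ∂ν + ∫ ω, (1 - p ω) * g ω ∂ν := by
    rw [integral_defect_eq hg hpg]; ring
  have h1 : ∫ ω, g ω ∂ν ≤ (1 + κ) * ∫ ω, p ω * g ω ∂ν := by rw [hsum]; linarith
  have hk : 0 < 1 + κ := by linarith
  calc (1 + κ)⁻¹ * ∫ ω, g ω ∂ν ≤ (1 + κ)⁻¹ * ((1 + κ) * ∫ ω, p ω * g ω ∂ν) :=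
        mul_le_mul_of_nonneg_left h1 (inv_nonneg.2 hk.le)
    _ = ∫ ω, p ω * g ω ∂ν := by rw [inv_mul_cancel_left₀ hk.ne']

end Defect

/-! ## §2 COUNT: the cube condition and the union bound

The cube's profile `p_σ` has the PLATEAU property: it equals `1` whenever every plaquette variable `X_i`, `i ∈ P(σ)`, of
the (enlarged) cube is strictly below the lowered threshold `a` (design (η): the Lipschitz profile is `1` on the inner
region; printed shape of the cube function: B15 p. 178 (1.3), a `sup` over the cube's plaquettes).  Hence the defect
`1 − p_σ` is dominated by the SUM of the one-plaquette indicators `𝟙{a ≤ |X_i|}` — a finite union bound, no measure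
theory — and a per-plaquette defect bound `q_i` sums to the floor `c = 1 − Σ q_i`, uniformly `c = 1 − P₀ · q̄`.
[folklore] -/

section Count

variable {Ω₀ : Type*} {ι : Type*}

/-- The LARGE-FIELD EVENT of ONE plaquette variable `X` at threshold `a`: `{a ≤ |X|}`. [folklore] -/
def lfEvent (X : Ω₀ → ℝ) (a : ℝ) : Set Ω₀ := {ω | a ≤ |X ω|}

/-- Membership in the large-field event, unfolded. [folklore] -/
theorem mem_lfEvent {X : Ω₀ → ℝ} {a : ℝ} {ω : Ω₀} : ω ∈ lfEvent X a ↔ a ≤ |X ω| := Iff.rfl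

/-- The event is measurable for a measurable plaquette variable. [folklore] -/
theorem measurableSet_lfEvent [MeasurableSpace Ω₀] {X : Ω₀ → ℝ} (hX : Measurable X) (a : ℝ) :
    MeasurableSet (lfEvent X a) :=
  measurableSet_le measurable_const (continuous_abs.measurable.comp hX)

/-- The one-plaquette indicator is `0` or `1`, in particular nonnegative and at most `1`. [folklore] -/
theorem indicator_lfEvent_nonneg (X : Ω₀ → ℝ) (a : ℝ) (ω : Ω₀) :
    0 ≤ (lfEvent X a).indicator (fun _ => (1 : ℝ)) ω := by
  by_cases hω : ω ∈ lfEvent X a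
  · rw [Set.indicator_of_mem hω]; exact zero_le_one
  · rw [Set.indicator_of_notMem hω]

/-- The one-plaquette indicator is at most `1`. [folklore] -/
theorem indicator_lfEvent_le_one (X : Ω₀ → ℝ) (a : ℝ) (ω : Ω₀) :
    (lfEvent X a).indicator (fun _ => (1 : ℝ)) ω ≤ 1 := by
  by_cases hω : ω ∈ lfEvent X a
  · rw [Set.indicator_of_mem hω]
  · rw [Set.indicator_of_notMem hω]; exact zero_le_one

/-- **THE CUBE CONDITION ⇒ THE COUNT** (structural, pointwise).  If the profile is nonnegative and equals `1` whenever
every plaquette variable of the cube is strictly below the threshold `a` (the plateau of the (η) profile; the `sup`-shape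
of B15 (1.3)), then its defect is dominated by the number of plaquettes at or above `a`:
`1 − p ω ≤ Σ_{i ∈ P} 𝟙{a ≤ |X_i ω|}`. [folklore] -/
theorem defect_le_count (P : Finset ι) (X : ι → Ω₀ → ℝ) {p : Ω₀ → ℝ} {a : ℝ} (hp0 : ∀ ω, 0 ≤ p ω)
    (hp1 : ∀ ω, (∀ i ∈ P, |X i ω| < a) → p ω = 1) (ω : Ω₀) :
    1 - p ω ≤ ∑ i ∈ P, (lfEvent (X i) a).indicator (fun _ => (1 : ℝ)) ω := by
  by_cases hall : ∀ i ∈ P, |X i ω| < a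
  · rw [hp1 ω hall, sub_self]
    exact sum_nonneg fun i _ => indicator_lfEvent_nonneg (X i) a ω
  · push Not at hall
    obtain ⟨i₀, hi₀, hge⟩ := hall
    have h1 : (lfEvent (X i₀) a).indicator (fun _ => (1 : ℝ)) ω = 1 := Set.indicator_of_mem (by exact hge) _
    calc 1 - p ω ≤ 1 := by linarith [hp0 ω]
      _ = (lfEvent (X i₀) a).indicator (fun _ => (1 : ℝ)) ω := h1.symm
      _ ≤ ∑ i ∈ P, (lfEvent (X i) a).indicator (fun _ => (1 : ℝ)) ω :=
          single_le_sum (fun i _ => indicator_lfEvent_nonneg (X i) a ω) hi₀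

variable [MeasurableSpace Ω₀] {ν : Measure Ω₀} {p g : Ω₀ → ℝ}

/-- **THE UNION BOUND, functional form.**  If the defect is dominated a.e. by a finite sum of nonnegative-weighted test
functions `e_i` (indicators, or directly the Chernoff weights), then the defect mass is at most the sum of the
`e_i`-weighted masses.  Integrability of each `e_i · g` is used (no junk values). [folklore] -/
theorem integral_defect_le_sum (P : Finset ι) (e : ι → Ω₀ → ℝ) (hg : Integrable g ν)
    (hpg : Integrable (fun ω => p ω * g ω) ν) (he : ∀ i ∈ P, Integrable (fun ω => e i ω * g ω) ν)
    (hg0 : 0 ≤ᵐ[ν] g) (hdom : ∀ᵐ ω ∂ν, 1 - p ω ≤ ∑ i ∈ P, e i ω) :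
    ∫ ω, (1 - p ω) * g ω ∂ν ≤ ∑ i ∈ P, ∫ ω, e i ω * g ω ∂ν := by
  rw [← integral_finsetSum P he]
  refine integral_mono_ae (integrable_defect hg hpg) (integrable_finsetSum P he) ?_
  filter_upwards [hdom, hg0] with ω hω hgω
  calc (1 - p ω) * g ω ≤ (∑ i ∈ P, e i ω) * g ω := mul_le_mul_of_nonneg_right hω hgω
    _ = ∑ i ∈ P, e i ω * g ω := sum_mul P (fun i => e i ω) (g ω)

/-- **COUNT ⇒ FLOOR `c = 1 − Σ_i q_i`.**  Per-plaquette defect bounds `∫ e_i · g ≤ q_i · ∫ g` sum to the floor.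
[folklore] -/
theorem smallFieldFloor_of_count (P : Finset ι) (e : ι → Ω₀ → ℝ) (q : ι → ℝ) (hg : Integrable g ν)
    (hpg : Integrable (fun ω => p ω * g ω) ν) (he : ∀ i ∈ P, Integrable (fun ω => e i ω * g ω) ν)
    (hg0 : 0 ≤ᵐ[ν] g) (hdom : ∀ᵐ ω ∂ν, 1 - p ω ≤ ∑ i ∈ P, e i ω)
    (hq : ∀ i ∈ P, ∫ ω, e i ω * g ω ∂ν ≤ q i * ∫ ω, g ω ∂ν) :
    SmallFieldFloor ν p g (1 - ∑ i ∈ P, q i) := by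
  refine smallFieldFloor_of_defect_le hg hpg ?_
  calc ∫ ω, (1 - p ω) * g ω ∂ν ≤ ∑ i ∈ P, ∫ ω, e i ω * g ω ∂ν := integral_defect_le_sum P e hg hpg he hg0 hdom
    _ ≤ ∑ i ∈ P, q i * ∫ ω, g ω ∂ν := sum_le_sum hq
    _ = (∑ i ∈ P, q i) * ∫ ω, g ω ∂ν := (sum_mul P q _).symm

/-- **UNIFORM COUNT ⇒ FLOOR `c = 1 − P₀ · q̄`.**  At most `P₀` plaquettes, each with defect bound `q̄ ≥ 0`. [folklore] -/
theorem smallFieldFloor_of_count_uniform (P : Finset ι) (e : ι → Ω₀ → ℝ) {P₀ : ℕ} {qbar : ℝ}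
    (hg : Integrable g ν) (hpg : Integrable (fun ω => p ω * g ω) ν)
    (he : ∀ i ∈ P, Integrable (fun ω => e i ω * g ω) ν) (hg0 : 0 ≤ᵐ[ν] g)
    (hdom : ∀ᵐ ω ∂ν, 1 - p ω ≤ ∑ i ∈ P, e i ω) (hq : ∀ i ∈ P, ∫ ω, e i ω * g ω ∂ν ≤ qbar * ∫ ω, g ω ∂ν)
    (hP : P.card ≤ P₀) (hqbar : 0 ≤ qbar) : SmallFieldFloor ν p g (1 - P₀ * qbar) := by
  have hfl := smallFieldFloor_of_count P e (fun _ => qbar) hg hpg he hg0 hdom hq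
  refine hfl.mono ?_ (integral_nonneg_of_ae hg0)
  rw [sum_const, nsmul_eq_mul]
  have : (P.card : ℝ) * qbar ≤ P₀ * qbar := mul_le_mul_of_nonneg_right (by exact_mod_cast hP) hqbar
  linarith

end Count

/-! ## §3 SUPPRESSION: the Chernoff factor at the (lowered) threshold, and the residual (Y′)

`𝟙{a ≤ |x|} ≤ e^{-γa²/2} · e^{γx²/2}` for `γ, a ≥ 0` — the threshold dependence of a one-plaquette large-field
probability is the explicit factor `e^{-γa²/2}` once an exponential moment `∫ e^{γX²/2} · g ≤ M · ∫ g` is available.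
That moment bound is the typed residual (Y′) `ExpMomentRatio` — NOT PRINTED (module header), an ESTIMATE, used below
only as a named binder. [folklore] -/

section Suppression

/-- **CHERNOFF, pointwise.**  For `γ ≥ 0`, `a ≥ 0` and `a ≤ |x|`: `1 ≤ e^{-γa²/2} · e^{γx²/2}`. [folklore] -/
theorem one_le_exp_mul_exp {γ a x : ℝ} (hγ : 0 ≤ γ) (ha : 0 ≤ a) (hx : a ≤ |x|) :
    1 ≤ Real.exp (-(γ * a ^ 2 / 2)) * Real.exp (γ * x ^ 2 / 2) := by
  rw [← Real.exp_add]
  refine Real.one_le_exp ?_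
  have hax : a ^ 2 ≤ x ^ 2 := by
    calc a ^ 2 ≤ |x| ^ 2 := pow_le_pow_left₀ ha hx 2
      _ = x ^ 2 := sq_abs x
  have := mul_le_mul_of_nonneg_left hax hγ
  linarith

/-- **CHERNOFF, indicator form**: `𝟙{a ≤ |X ω|} ≤ e^{-γa²/2} · e^{γ (X ω)²/2}` at every point. [folklore] -/
theorem indicator_le_exp_mul_exp {Ω₀ : Type*} (X : Ω₀ → ℝ) {γ a : ℝ} (hγ : 0 ≤ γ) (ha : 0 ≤ a) (ω : Ω₀) :
    (lfEvent X a).indicator (fun _ => (1 : ℝ)) ω ≤ Real.exp (-(γ * a ^ 2 / 2)) * Real.exp (γ * X ω ^ 2 / 2) := by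
  by_cases hω : ω ∈ lfEvent X a
  · rw [Set.indicator_of_mem hω]; exact one_le_exp_mul_exp hγ ha hω
  · rw [Set.indicator_of_notMem hω]; positivity

variable {Ω₀ : Type*} [MeasurableSpace Ω₀]

/-- **(Y′) THE ONE-PLAQUETTE EXPONENTIAL-MOMENT RATIO** (hypothesis shape, NOT PRINTED; SPECIES = the cell's E2REL-b /
NE7b-at-lowered-threshold family in primitive, threshold-free form — a one-run one-plaquette Gaussian-domination
statement; printed MECHANISM = B16 p. 380 «by expanding the Wilson action
locally in the approximate fluctuation field, and using the positivity bound for the resulting quadratic form», F-T4-46).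
On one fibre with measure `ν`, weight `g` (the substituted density stripped of the slot's factor, `≥ 0`) and plaquette
variable `X`: the function `e^{γX²/2} · g` is integrable and its mass is at most `M` times the total mass.  With
`γ = γ₀ · g_j⁻²` this says `X` is sub-Gaussian AT SCALE `g_j` under the pinned substituted density — an ESTIMATE, not
structure; `M = O(1)` is the content (the crude bound without the Wilson factor is `e^{O(g_j⁻²)}`).  Integrability is
PART of the shape, so it is never junk-true. [folklore] -/
def ExpMomentRatio (ν : Measure Ω₀) (X g : Ω₀ → ℝ) (γ M : ℝ) : Prop :=
  Integrable (fun ω => Real.exp (γ * X ω ^ 2 / 2) * g ω) ν ∧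
    ∫ ω, Real.exp (γ * X ω ^ 2 / 2) * g ω ∂ν ≤ M * ∫ ω, g ω ∂ν

/-- (Y′) is monotone in the constant (nonnegative total mass). [folklore] -/
theorem ExpMomentRatio.mono {ν : Measure Ω₀} {X g : Ω₀ → ℝ} {γ M M' : ℝ} (h : ExpMomentRatio ν X g γ M)
    (hM : M ≤ M') (hg : 0 ≤ ∫ ω, g ω ∂ν) : ExpMomentRatio ν X g γ M' :=
  ⟨h.1, h.2.trans (mul_le_mul_of_nonneg_right hM hg)⟩

/-- The trivial inhabitant: at `γ = 0` the shape holds with `M = 1` for any integrable weight (non-vacuity of the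
shape; the content is `γ = γ₀ g_j⁻² > 0`). [folklore] -/
theorem expMomentRatio_zero {ν : Measure Ω₀} (X : Ω₀ → ℝ) {g : Ω₀ → ℝ} (hg : Integrable g ν) :
    ExpMomentRatio ν X g 0 1 := by
  have h1 : (fun ω => Real.exp (0 * X ω ^ 2 / 2) * g ω) = g := by
    funext ω; simp
  refine ⟨by rw [h1]; exact hg, ?_⟩
  rw [h1, one_mul]

/-- The one-plaquette indicator weight `𝟙{a ≤ |X|} · g` is integrable for measurable `X` and integrable `g`. [folklore] -/
theorem integrable_indicator_mul {ν : Measure Ω₀} {X g : Ω₀ → ℝ} (hX : Measurable X) (a : ℝ)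
    (hg : Integrable g ν) : Integrable (fun ω => (lfEvent X a).indicator (fun _ => (1 : ℝ)) ω * g ω) ν := by
  refine (hg.indicator (measurableSet_lfEvent hX a)).congr (Filter.Eventually.of_forall fun ω => ?_)
  by_cases hω : ω ∈ lfEvent X a
  · simp [Set.indicator_of_mem hω]
  · simp [Set.indicator_of_notMem hω]

/-- **ONE PLAQUETTE: CHERNOFF × (Y′).**  `∫ 𝟙{a ≤ |X|} · g ≤ M · e^{-γa²/2} · ∫ g`. [folklore] -/
theorem integral_indicator_mul_le {ν : Measure Ω₀} {X g : Ω₀ → ℝ} {γ a M : ℝ} (hX : Measurable X) (hγ : 0 ≤ γ)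
    (ha : 0 ≤ a) (hg0 : 0 ≤ᵐ[ν] g) (hg : Integrable g ν) (hE : ExpMomentRatio ν X g γ M) :
    ∫ ω, (lfEvent X a).indicator (fun _ => (1 : ℝ)) ω * g ω ∂ν
      ≤ M * Real.exp (-(γ * a ^ 2 / 2)) * ∫ ω, g ω ∂ν := by
  have hig := integrable_indicator_mul hX a hg (ν := ν)
  have hcg : Integrable (fun ω => (Real.exp (-(γ * a ^ 2 / 2)) * Real.exp (γ * X ω ^ 2 / 2)) * g ω) ν :=
    (hE.1.const_mul (Real.exp (-(γ * a ^ 2 / 2)))).congr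
      (Filter.Eventually.of_forall fun ω => by ring)
  calc ∫ ω, (lfEvent X a).indicator (fun _ => (1 : ℝ)) ω * g ω ∂ν
      ≤ ∫ ω, (Real.exp (-(γ * a ^ 2 / 2)) * Real.exp (γ * X ω ^ 2 / 2)) * g ω ∂ν := by
        refine integral_mono_ae hig hcg ?_
        filter_upwards [hg0] with ω hgω
        exact mul_le_mul_of_nonneg_right (indicator_le_exp_mul_exp X hγ ha ω) hgω
    _ = Real.exp (-(γ * a ^ 2 / 2)) * ∫ ω, Real.exp (γ * X ω ^ 2 / 2) * g ω ∂ν := by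
        rw [← integral_const_mul]
        exact integral_congr_ae (Filter.Eventually.of_forall fun ω => by ring)
    _ ≤ Real.exp (-(γ * a ^ 2 / 2)) * (M * ∫ ω, g ω ∂ν) :=
        mul_le_mul_of_nonneg_left hE.2 (Real.exp_pos _).le
    _ = M * Real.exp (-(γ * a ^ 2 / 2)) * ∫ ω, g ω ∂ν := by ring

end Suppression

/-! ## §4 ASSEMBLY: (Y) ⇐ COUNT × SUPPRESSION × (Y′), the floor constant explicit

One fibre: `c = 1 − P₀ · M · e^{-γa²/2}`.  Uniformly over the fibres `j ∈ J` of `UniformSmallFieldFloor` (in the cell: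
`(K, t, ℓ, history, σ, x_{Z′ᶜ})`): ONE exponent floor `β ≤ γ_j a_j²/2` (the dictionary of §5 makes `γ_j a_j²/2`
`g_j`-free), ONE moment constant `M`, ONE count `P₀`, and the smallness `P₀ · M · e^{-β} < 1` — all BINDERS. [folklore] -/

section Assembly

variable {Ω₀ : Type*} [MeasurableSpace Ω₀] {ν : Measure Ω₀} {p g : Ω₀ → ℝ} {ι : Type*}

/-- **(Y) ON ONE FIBRE ⇐ COUNT × SUPPRESSION × (Y′).**  Data: the cube's finite plaquette set `P`, `|P| ≤ P₀`, with
measurable plaquette variables `X_i`; the lowered threshold `a ≥ 0` and `γ ≥ 0`; the weight `g ≥ 0` a.e., `g` and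
`p·g` integrable; the CUBE CONDITION in its a.e. consequence `1 − p ≤ Σ_{i∈P} 𝟙{a ≤ |X_i|}` (`defect_le_count`); the
residual (Y′) for every plaquette of the cube with ONE constant `M ≥ 0`.  Conclusion: the floor (Y) with
`c = 1 − P₀ · (M · e^{-γa²/2})`.  CONDITIONAL on its binders; nothing PRINTED is asserted. [folklore] -/
theorem smallFieldFloor_of_count_suppression (P : Finset ι) (X : ι → Ω₀ → ℝ) {P₀ : ℕ} {γ a M : ℝ}
    (hX : ∀ i ∈ P, Measurable (X i)) (hγ : 0 ≤ γ) (ha : 0 ≤ a) (hM : 0 ≤ M) (hg : Integrable g ν)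
    (hpg : Integrable (fun ω => p ω * g ω) ν) (hg0 : 0 ≤ᵐ[ν] g)
    (hdom : ∀ᵐ ω ∂ν, 1 - p ω ≤ ∑ i ∈ P, (lfEvent (X i) a).indicator (fun _ => (1 : ℝ)) ω)
    (hE : ∀ i ∈ P, ExpMomentRatio ν (X i) g γ M) (hP : P.card ≤ P₀) :
    SmallFieldFloor ν p g (1 - P₀ * (M * Real.exp (-(γ * a ^ 2 / 2)))) :=
  smallFieldFloor_of_count_uniform P (fun i ω => (lfEvent (X i) a).indicator (fun _ => (1 : ℝ)) ω) hg hpg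
    (fun i hi => integrable_indicator_mul (hX i hi) a hg) hg0 hdom
    (fun i hi => integral_indicator_mul_le (hX i hi) hγ ha hg0 hg (hE i hi)) hP
    (mul_nonneg hM (Real.exp_pos _).le)

/-- The same with the cube condition supplied POINTWISE by the plateau of the profile (`defect_le_count`). [folklore] -/
theorem smallFieldFloor_of_cubeCondition (P : Finset ι) (X : ι → Ω₀ → ℝ) {P₀ : ℕ} {γ a M : ℝ}
    (hX : ∀ i ∈ P, Measurable (X i)) (hγ : 0 ≤ γ) (ha : 0 ≤ a) (hM : 0 ≤ M) (hg : Integrable g ν)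
    (hpg : Integrable (fun ω => p ω * g ω) ν) (hg0 : 0 ≤ᵐ[ν] g) (hp0 : ∀ ω, 0 ≤ p ω)
    (hp1 : ∀ ω, (∀ i ∈ P, |X i ω| < a) → p ω = 1) (hE : ∀ i ∈ P, ExpMomentRatio ν (X i) g γ M)
    (hP : P.card ≤ P₀) : SmallFieldFloor ν p g (1 - P₀ * (M * Real.exp (-(γ * a ^ 2 / 2)))) :=
  smallFieldFloor_of_count_suppression P X hX hγ ha hM hg hpg hg0
    (Filter.Eventually.of_forall (defect_le_count P X hp0 hp1)) hE hP

/-- **(Y) UNIFORMLY ⇐ COUNT × SUPPRESSION × (Y′) ON EVERY FIBRE.**  Over the fibre index `J` of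
`T4SiblingInsertion.UniformSmallFieldFloor`: per fibre the data of `smallFieldFloor_of_count_suppression` with
fibre-dependent threshold `a_j ≥ 0` and `γ_j ≥ 0` but ONE exponent floor `β ≤ γ_j · a_j² / 2`, ONE `M ≥ 0`, ONE `P₀`;
and the EXPLICIT smallness binder `P₀ · (M · e^{-β}) < 1`.  Conclusion: `UniformSmallFieldFloor ν p g c` with
`c = 1 − P₀ · (M · e^{-β}) > 0` — what the socket consumes as `rσ = c⁻¹`
(`T4SiblingInsertion.UniformSmallFieldFloor.integral_mul_le`).  CONDITIONAL on its binders: (Y′), the uniformity of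
`M`, `P₀`, `β` in the fibre, and the smallness are NOT asserted. [folklore] -/
theorem uniformSmallFieldFloor_of_count_suppression {J : Type*} {Ω₁ : J → Type*}
    [∀ j, MeasurableSpace (Ω₁ j)] {ν : (j : J) → Measure (Ω₁ j)} {p g : (j : J) → Ω₁ j → ℝ}
    (P : J → Finset ι) (X : (j : J) → ι → Ω₁ j → ℝ) {P₀ : ℕ} (γ a : J → ℝ) {β M : ℝ}
    (hX : ∀ j, ∀ i ∈ P j, Measurable (X j i)) (hγ : ∀ j, 0 ≤ γ j) (ha : ∀ j, 0 ≤ a j) (hM : 0 ≤ M)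
    (hβ : ∀ j, β ≤ γ j * a j ^ 2 / 2) (hg : ∀ j, Integrable (g j) (ν j))
    (hpg : ∀ j, Integrable (fun ω => p j ω * g j ω) (ν j)) (hg0 : ∀ j, 0 ≤ᵐ[ν j] g j)
    (hdom : ∀ j, ∀ᵐ ω ∂ν j, 1 - p j ω ≤ ∑ i ∈ P j, (lfEvent (X j i) (a j)).indicator (fun _ => (1 : ℝ)) ω)
    (hE : ∀ j, ∀ i ∈ P j, ExpMomentRatio (ν j) (X j i) (g j) (γ j) M) (hP : ∀ j, (P j).card ≤ P₀)
    (hc : P₀ * (M * Real.exp (-β)) < 1) :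
    UniformSmallFieldFloor ν p g (1 - P₀ * (M * Real.exp (-β))) := by
  refine ⟨by linarith, fun j => ?_⟩
  have h := smallFieldFloor_of_count_suppression (P j) (X j) (hX j) (hγ j) (ha j) hM (hg j) (hpg j) (hg0 j)
    (hdom j) (hE j) (hP j)
  refine h.mono ?_ (integral_nonneg_of_ae (hg0 j))
  have hexp : Real.exp (-(γ j * a j ^ 2 / 2)) ≤ Real.exp (-β) := Real.exp_le_exp.2 (by linarith [hβ j])
  have : (P₀ : ℝ) * (M * Real.exp (-(γ j * a j ^ 2 / 2))) ≤ P₀ * (M * Real.exp (-β)) :=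
    mul_le_mul_of_nonneg_left (mul_le_mul_of_nonneg_left hexp hM) (Nat.cast_nonneg _)
  linarith

/-- **(Y) UNIFORMLY FROM ONE DEFECT BUDGET, fibre-dependent constants.**  Per fibre `j`: its own count `|P_j|`,
moment constant `M_j ≥ 0`, `γ_j, a_j ≥ 0`, and the single budget `|P_j| · (M_j · e^{-γ_j a_j²/2}) ≤ 1 − c` with
`0 < c`.  Conclusion: `UniformSmallFieldFloor ν p g c`.  (The form the power counting of §5 feeds, with `c = 1/2`.)
CONDITIONAL on its binders. [folklore] -/
theorem uniformSmallFieldFloor_of_budget {J : Type*} {Ω₁ : J → Type*}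
    [∀ j, MeasurableSpace (Ω₁ j)] {ν : (j : J) → Measure (Ω₁ j)} {p g : (j : J) → Ω₁ j → ℝ}
    (P : J → Finset ι) (X : (j : J) → ι → Ω₁ j → ℝ) (γ a M : J → ℝ) {c : ℝ}
    (hX : ∀ j, ∀ i ∈ P j, Measurable (X j i)) (hγ : ∀ j, 0 ≤ γ j) (ha : ∀ j, 0 ≤ a j) (hM : ∀ j, 0 ≤ M j)
    (hg : ∀ j, Integrable (g j) (ν j)) (hpg : ∀ j, Integrable (fun ω => p j ω * g j ω) (ν j))
    (hg0 : ∀ j, 0 ≤ᵐ[ν j] g j)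
    (hdom : ∀ j, ∀ᵐ ω ∂ν j, 1 - p j ω ≤ ∑ i ∈ P j, (lfEvent (X j i) (a j)).indicator (fun _ => (1 : ℝ)) ω)
    (hE : ∀ j, ∀ i ∈ P j, ExpMomentRatio (ν j) (X j i) (g j) (γ j) (M j)) (hc : 0 < c)
    (hbudget : ∀ j, ((P j).card : ℝ) * (M j * Real.exp (-(γ j * a j ^ 2 / 2))) ≤ 1 - c) :
    UniformSmallFieldFloor ν p g c := by
  refine ⟨hc, fun j => ?_⟩
  have h := smallFieldFloor_of_count_suppression (P j) (X j) (hX j) (hγ j) (ha j) (hM j) (hg j) (hpg j) (hg0 j)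
    (hdom j) (hE j) le_rfl
  exact h.mono (by linarith [hbudget j]) (integral_nonneg_of_ae (hg0 j))

/-- **THE CONSUMER'S CONSTANT.**  Under the same data the kernel-ratio constant the socket wants is
`rσ = (1 − P₀ · (M · e^{-β}))⁻¹ ≥ 0`, and any modification `ψ ≤ 1` a.e. of the slot's factor (the shell indicators)
has `∫ ψ · g_j ≤ rσ · ∫ p_j · g_j` on every fibre — `UniformSmallFieldFloor.integral_mul_le` applied to the floor
just assembled.  Bookkeeping only. [folklore] -/
theorem integral_mul_le_of_count_suppression {J : Type*} {Ω₁ : J → Type*}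
    [∀ j, MeasurableSpace (Ω₁ j)] {ν : (j : J) → Measure (Ω₁ j)} {p g : (j : J) → Ω₁ j → ℝ}
    (P : J → Finset ι) (X : (j : J) → ι → Ω₁ j → ℝ) {P₀ : ℕ} (γ a : J → ℝ) {β M : ℝ}
    (hX : ∀ j, ∀ i ∈ P j, Measurable (X j i)) (hγ : ∀ j, 0 ≤ γ j) (ha : ∀ j, 0 ≤ a j) (hM : 0 ≤ M)
    (hβ : ∀ j, β ≤ γ j * a j ^ 2 / 2) (hg : ∀ j, Integrable (g j) (ν j))
    (hpg : ∀ j, Integrable (fun ω => p j ω * g j ω) (ν j)) (hg0 : ∀ j, 0 ≤ᵐ[ν j] g j)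
    (hdom : ∀ j, ∀ᵐ ω ∂ν j, 1 - p j ω ≤ ∑ i ∈ P j, (lfEvent (X j i) (a j)).indicator (fun _ => (1 : ℝ)) ω)
    (hE : ∀ j, ∀ i ∈ P j, ExpMomentRatio (ν j) (X j i) (g j) (γ j) M) (hP : ∀ j, (P j).card ≤ P₀)
    (hc : P₀ * (M * Real.exp (-β)) < 1) {j : J} {ψ : Ω₁ j → ℝ} (hψ : ∀ᵐ ω ∂ν j, ψ ω ≤ 1)
    (hψg : Integrable (fun ω => ψ ω * g j ω) (ν j)) :
    ∫ ω, ψ ω * g j ω ∂ν j ≤ (1 - P₀ * (M * Real.exp (-β)))⁻¹ * ∫ ω, p j ω * g j ω ∂ν j :=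
  (uniformSmallFieldFloor_of_count_suppression P X γ a hX hγ ha hM hβ hg hpg hg0 hdom hE hP hc).integral_mul_le
    hψ (hg0 j) hψg (hg j)

end Assembly

/-! ## §5 DICTIONARY and POWER COUNTING (real analysis)

The lowered threshold of design (η) is `a = (1 − ρ₀) · θ` with the printed-type threshold `θ = g · P` (thresholds are
`g_j · p₀(g_j) · (…)`, B15 p. 175 / F-T4-36), and `γ = γ₀ · g⁻²`: the exponent `γa²/2 = ½γ₀(1−ρ₀)²P²` does not see
`g` — the printed TYPE `e^{-O(1)·p₀(g_j)²}` of the fundamental large-field factors (B16 p. 381), with the lowering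
costing exactly `(1−ρ₀)²`.  And a polylogarithmic count against a higher-power exponent leaves `c ≥ 1/2` eventually:
WHICH printed parameter window gives the power ordering `s < q` is NOT asserted (binder `hsq`). [folklore] -/

section Dictionary

/-- **THE EXPONENT IS `g`-FREE.**  `(γ₀ / g²) · ((1 − ρ₀) · (g · P))² / 2 = γ₀ · (1 − ρ₀)² · P² / 2` for `g ≠ 0`.
[folklore] -/
theorem suppressionExponent_eq {γ₀ ρ₀ g P : ℝ} (hg : g ≠ 0) :
    γ₀ / g ^ 2 * ((1 - ρ₀) * (g * P)) ^ 2 / 2 = γ₀ * (1 - ρ₀) ^ 2 * P ^ 2 / 2 := by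
  field_simp

/-- The lowering factor: for `0 ≤ ρ₀ ≤ 1` the (η) exponent is the un-lowered one times `(1 − ρ₀)² ∈ [0, 1]` — the
price of design (η)'s lowered threshold in the exponent, nothing else. [folklore] -/
theorem suppressionExponent_lowered_le {γ₀ ρ₀ P : ℝ} (hγ₀ : 0 ≤ γ₀) (hρ₀ : 0 ≤ ρ₀) (hρ₁ : ρ₀ ≤ 1) :
    γ₀ * (1 - ρ₀) ^ 2 * P ^ 2 / 2 ≤ γ₀ * P ^ 2 / 2 := by
  have h1 : (1 - ρ₀) ^ 2 ≤ 1 := by nlinarith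
  have h2 : 0 ≤ γ₀ * P ^ 2 := mul_nonneg hγ₀ (sq_nonneg P)
  nlinarith

/-- **POWER COUNTING.**  If the count × moment constant grows at most like `B · e^{C·x^s}` and the exponent is at least
`A · x^q` with naturals `s < q` (`x = log g⁻²`), then the product is at most `1/2` for `x ≥ x₀`, with the explicit
`x₀ = max 1 (max (2C/A) (4B/A))`. [folklore] -/
theorem eventually_count_mul_suppression_le_half {A B C : ℝ} {s q : ℕ} (hA : 0 < A) (hB : 0 ≤ B) (hC : 0 ≤ C)
    (hsq : s < q) :
    ∀ x, max 1 (max (2 * C / A) (4 * B / A)) ≤ x →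
      B * Real.exp (C * x ^ s) * Real.exp (-(A * x ^ q)) ≤ 1 / 2 := by
  intro x hx
  have hx1 : 1 ≤ x := le_trans (le_max_left _ _) hx
  have hxC : 2 * C / A ≤ x := le_trans ((le_max_left _ _).trans (le_max_right _ _)) hx
  have hxB : 4 * B / A ≤ x := le_trans ((le_max_right _ _).trans (le_max_right _ _)) hx
  have hCx : 2 * C ≤ A * x := by rw [div_le_iff₀ hA] at hxC; linarith
  have hBx : 4 * B ≤ A * x := by rw [div_le_iff₀ hA] at hxB; linarith
  have hxs1 : 1 ≤ x ^ s := one_le_pow₀ hx1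
  have hpow : x ^ s * x ≤ x ^ q := by
    calc x ^ s * x = x ^ (s + 1) := (pow_succ x s).symm
      _ ≤ x ^ q := pow_le_pow_right₀ hx1 (Nat.succ_le_of_lt hsq)
  have hexp_le : C * x ^ s + -(A * x ^ q) ≤ -(A * x / 2) := by
    have e1 : x ^ s * (C - A * x) = C * x ^ s - A * (x ^ s * x) := by ring
    have h1 : C * x ^ s - A * x ^ q ≤ x ^ s * (C - A * x) := by
      rw [e1]; have := mul_le_mul_of_nonneg_left hpow hA.le; linarith
    have hneg : C - A * x ≤ 0 := by linarith
    have h2 : x ^ s * (C - A * x) ≤ C - A * x := by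
      nlinarith [mul_nonneg (sub_nonneg.2 hxs1) (neg_nonneg.2 hneg)]
    linarith
  have hB2 : 2 * B ≤ Real.exp (A * x / 2) := by
    have := Real.add_one_le_exp (A * x / 2)
    linarith
  rw [mul_assoc, ← Real.exp_add]
  calc B * Real.exp (C * x ^ s + -(A * x ^ q)) ≤ B * Real.exp (-(A * x / 2)) :=
        mul_le_mul_of_nonneg_left (Real.exp_le_exp.2 hexp_le) hB
    _ ≤ 1 / 2 := by
        have hpos : 0 < Real.exp (A * x / 2) := Real.exp_pos _
        rw [Real.exp_neg, ← div_eq_mul_inv, div_le_iff₀ hpos]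
        linarith

/-- **⇒ THE FLOOR IS AT LEAST `1/2` EVENTUALLY.**  For `x ≥ x₀` (explicit as above): whenever the fibre-uniform count and
moment constant satisfy `P₀ · M ≤ B · e^{C·x^s}` and the exponent floor satisfies `A · x^q ≤ β`, the constant of
`uniformSmallFieldFloor_of_count_suppression` obeys `1/2 ≤ 1 − P₀ · (M · e^{-β})` (so the smallness binder holds and
`rσ = c⁻¹ ≤ 2`).  Which printed window supplies `s < q`, `B`, `C`, `A` is NOT asserted. [folklore] -/
theorem floor_ge_half_of_powerCounting {A B C : ℝ} {s q : ℕ} (hA : 0 < A) (hB : 0 ≤ B) (hC : 0 ≤ C) (hsq : s < q)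
    {x : ℝ} (hx : max 1 (max (2 * C / A) (4 * B / A)) ≤ x) {P₀ : ℕ} {M β : ℝ}
    (hPM : (P₀ : ℝ) * M ≤ B * Real.exp (C * x ^ s)) (hβ : A * x ^ q ≤ β) :
    1 / 2 ≤ 1 - P₀ * (M * Real.exp (-β)) := by
  have h := eventually_count_mul_suppression_le_half hA hB hC hsq x hx
  have h1 : (P₀ : ℝ) * (M * Real.exp (-β)) ≤ B * Real.exp (C * x ^ s) * Real.exp (-(A * x ^ q)) := by
    rw [← mul_assoc]
    exact mul_le_mul hPM (Real.exp_le_exp.2 (by linarith)) (Real.exp_pos _).le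
      (mul_nonneg hB (Real.exp_pos _).le)
  linarith

/-- **END TO END: (Y) WITH `c = 1/2` FROM COUNT × SUPPRESSION × (Y′) AND POWER COUNTING.**  Per fibre `j` the data of
`uniformSmallFieldFloor_of_budget` and a size parameter `x_j` (`= log g_j⁻²` in the cell) beyond the explicit threshold
`x₀ = max 1 (max (2C/A) (4B/A))`, with count × moment `|P_j| · M_j ≤ B · e^{C·x_j^s}` and exponent
`A · x_j^q ≤ γ_j a_j²/2`, naturals `s < q`.  Conclusion: `UniformSmallFieldFloor ν p g (1/2)` — the floor (Y) with
`c = 1/2`, i.e. `rσ = 2` for the socket.  EVERY analytic input is a binder: (Y′) (`hE`, NOT PRINTED), the growth of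
count × moment (`hPM`), the exponent floor (`hβ`) and the power ordering (`hsq`); nothing of print is asserted.
[folklore] -/
theorem uniformSmallFieldFloor_half_of_powerCounting {ι J : Type*} {Ω₁ : J → Type*}
    [∀ j, MeasurableSpace (Ω₁ j)] {ν : (j : J) → Measure (Ω₁ j)} {p g : (j : J) → Ω₁ j → ℝ}
    (P : J → Finset ι) (X : (j : J) → ι → Ω₁ j → ℝ) (γ a M x : J → ℝ) {A B C : ℝ} {s q : ℕ}
    (hA : 0 < A) (hB : 0 ≤ B) (hC : 0 ≤ C) (hsq : s < q)
    (hX : ∀ j, ∀ i ∈ P j, Measurable (X j i)) (hγ : ∀ j, 0 ≤ γ j) (ha : ∀ j, 0 ≤ a j) (hM : ∀ j, 0 ≤ M j)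
    (hg : ∀ j, Integrable (g j) (ν j)) (hpg : ∀ j, Integrable (fun ω => p j ω * g j ω) (ν j))
    (hg0 : ∀ j, 0 ≤ᵐ[ν j] g j)
    (hdom : ∀ j, ∀ᵐ ω ∂ν j, 1 - p j ω ≤ ∑ i ∈ P j, (lfEvent (X j i) (a j)).indicator (fun _ => (1 : ℝ)) ω)
    (hE : ∀ j, ∀ i ∈ P j, ExpMomentRatio (ν j) (X j i) (g j) (γ j) (M j))
    (hx : ∀ j, max 1 (max (2 * C / A) (4 * B / A)) ≤ x j)
    (hPM : ∀ j, ((P j).card : ℝ) * M j ≤ B * Real.exp (C * x j ^ s)) (hβ : ∀ j, A * x j ^ q ≤ γ j * a j ^ 2 / 2) :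
    UniformSmallFieldFloor ν p g (1 / 2) := by
  refine uniformSmallFieldFloor_of_budget P X γ a M hX hγ ha hM hg hpg hg0 hdom hE (by norm_num) fun j => ?_
  have h := floor_ge_half_of_powerCounting hA hB hC hsq (hx j) (hPM j) (hβ j)
  linarith

end Dictionary

/-! ## §6 SANITY (honest scope): a two-point toy fibre on which §4 FIRES non-degenerately, and a negative control

Toy, not Bałaban's densities.  Fibre `Bool` with the counting measure; one plaquette (`ι = Unit`) with variable
`X true = 1`, `X false = 0`; threshold `a = 1` (so the large-field event is `{true}`, of mass `1`); weight `g ≡ 1`;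
profile `p true = 0`, `p false = 1` (plateau off the event).  (Y′) holds with `γ = 2`, `M = (1 + e)/2 > 1`; the
assembled floor constant is `c = 1 − 1 · (M · e^{-1}) = (1 − e^{-1})/2 ∈ (0, 1/2)`, and indeed `∫ p·g = 1`,
`∫ g = 2`.  NEGATIVE CONTROL: without `0 ≤ a` the Chernoff inequality of §3 is false. [folklore] -/

namespace Sanity

/-- Negative control (kernel-checked): the sign hypothesis `0 ≤ a` of `one_le_exp_mul_exp` cannot be dropped —
at `γ = 2`, `a = -1`, `x = 0` one has `a ≤ |x|` but `e^{-γa²/2} · e^{γx²/2} = e^{-1} < 1`. [folklore] -/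
example : ¬ ∀ γ a x : ℝ, 0 ≤ γ → a ≤ |x| → 1 ≤ Real.exp (-(γ * a ^ 2 / 2)) * Real.exp (γ * x ^ 2 / 2) := by
  intro h
  have h1 := h 2 (-1) 0 (by norm_num) (by norm_num)
  have h2 : Real.exp (-(2 * (-1 : ℝ) ^ 2 / 2)) * Real.exp (2 * (0 : ℝ) ^ 2 / 2) = Real.exp (-1) := by norm_num
  rw [h2] at h1
  have h3 : Real.exp (-1) < 1 := Real.exp_lt_one_iff.2 (by norm_num)
  linarith

/-- The toy plaquette variable (toy data, not Bałaban's). [folklore] -/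
def X : Bool → ℝ := fun b => if b then 1 else 0
/-- The toy profile: `1` off the large-field event, `0` on it (toy data). [folklore] -/
def p : Bool → ℝ := fun b => if b then 0 else 1
/-- The toy weight (toy data). [folklore] -/
def g : Bool → ℝ := fun _ => 1

/-- The toy variable is measurable (discrete fibre). [folklore] -/
theorem measurable_X : Measurable X := Measurable.of_discrete

/-- Bochner integral over the two-point fibre with counting measure. [folklore] -/
theorem integral_bool (f : Bool → ℝ) : ∫ b, f b ∂(Measure.count : Measure Bool) = f true + f false := by
  rw [integral_count, Fintype.sum_bool]

/-- (Y′) holds on the toy with `γ = 2`, `M = (1 + e)/2` (toy). [folklore] -/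
theorem expMomentRatio_toy : ExpMomentRatio (Measure.count : Measure Bool) X g 2 ((1 + Real.exp 1) / 2) := by
  refine ⟨Integrable.of_finite, ?_⟩
  rw [integral_bool, integral_bool]
  simp [X, g]
  linarith

/-- The assembled §4 theorem FIRES on the toy: floor constant `c = 1 − 1 · ((1 + e)/2 · e^{-(2·1²/2)})` (toy).
[folklore] -/
theorem floor_toy : SmallFieldFloor (Measure.count : Measure Bool) p g
    (1 - (1 : ℕ) * ((1 + Real.exp 1) / 2 * Real.exp (-(2 * (1 : ℝ) ^ 2 / 2)))) :=
  smallFieldFloor_of_cubeCondition ({()} : Finset Unit) (fun _ => X) (fun _ _ => measurable_X) (by norm_num)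
    (by norm_num) (by positivity) Integrable.of_finite Integrable.of_finite
    (Filter.Eventually.of_forall fun b => by simp [g]) (fun b => by cases b <;> simp [p])
    (fun b hb => by
      cases b
      · simp [p]
      · have := hb () (mem_singleton_self _); simp [X] at this)
    (fun _ _ => expMomentRatio_toy) (by simp)

/-- The toy's floor constant is NON-degenerate: `0 < c < 1/2` (`c = (1 − e^{-1})/2`), while the true conditional
probability is exactly `1/2` (`∫ p·g = 1`, `∫ g = 2`) (toy). [folklore] -/
theorem floor_toy_const :
    (0 : ℝ) < 1 - (1 : ℕ) * ((1 + Real.exp 1) / 2 * Real.exp (-(2 * (1 : ℝ) ^ 2 / 2))) ∧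
    1 - (1 : ℕ) * ((1 + Real.exp 1) / 2 * Real.exp (-(2 * (1 : ℝ) ^ 2 / 2))) < 1 / 2 := by
  have he : Real.exp 1 * Real.exp (-1) = 1 := by rw [← Real.exp_add]; norm_num
  have hpos : 0 < Real.exp (-1) := Real.exp_pos _
  have hlt : Real.exp (-1) < 1 := Real.exp_lt_one_iff.2 (by norm_num)
  constructor
  · norm_num
    nlinarith
  · norm_num
    nlinarith

end Sanity

end Literature.MathematicalPhysics.QuantumFieldTheory.Balaban1983to89.T4SmallFieldFloorCount
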